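import Summits.ValiantsHypothesis.ValiantsHypothesis.Theorems.LacunarySymmetroidMatrixDescartesCensusV20CoverX
import Summits.ValiantsHypothesis.ValiantsHypothesis.Theorems.LacunarySymmetroidMatrixDescartesCensusV20Box26Keys

/-!
# `MatrixDescartes` census — BOX26 minus residue, `V = 20` layer: COVER CHECK B (`d₅ = 26`) with the residue as exception list

HONEST FRAMING.  Object-search cell `pub-symmetroid`; door-A item `DoorA26 = PosRootLawAt 2 6 19`
(stmt-ValiantsHypothesis-19979; OPEN, typed, never asserted).  Kernel check (`decide +kernel` of `V20.coverSlicesX`, `…CensusV20CoverX`): for the listed slices `(d₅, d₄-range)` of the sorted supports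
`0 = d₀ < ⋯ < d₅`, every support whose 21 pair sums are distinct is in `box26Open`, or a key of `…CensusV20Box26Keys`, or the mirror
of one.  Enumeration bookkeeping; soundness `V20.box_of_planX` (`…CensusV20SoundCoverX`), use `…CensusV20Box26`.  Nothing here bears on `V = 19`, on `ζ_sym(2,6)` over all supports, on `DoorA26` itself, on `MatrixDescartes`
(stmt-ValiantsHypothesis-18050) or on `VP ≠ VNP`.

[folklore] Certificate-checker soundness / replay; elementary.
-/

-- the D-0017 layout repeats a namespace component (single-conjunct summit); the `dupNamespace` linter flags it; name mandated.
set_option linter.dupNamespace false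

namespace Summit.ValiantsHypothesis.ValiantsHypothesis.Theorems.LacunarySymmetroidMatrixDescartes.Census.V20

/-- Cover check (exceptions `box26Open`) of the slices `[(26, 4, 19)]` against `box26Keys`. [folklore] -/
theorem cover26_b1 : coverSlicesX box26Open box26Keys [(26, 4, 19)] = true := by decide +kernel

/-- Cover check (exceptions `box26Open`) of the slices `[(26, 20, 22)]` against `box26Keys`. [folklore] -/
theorem cover26_b2 : coverSlicesX box26Open box26Keys [(26, 20, 22)] = true := by decide +kernel

/-- Cover check (exceptions `box26Open`) of the slices `[(26, 23, 25)]` against `box26Keys`. [folklore] -/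
theorem cover26_b3 : coverSlicesX box26Open box26Keys [(26, 23, 25)] = true := by decide +kernel

end Summit.ValiantsHypothesis.ValiantsHypothesis.Theorems.LacunarySymmetroidMatrixDescartes.Census.V20
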